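import Literature.IUT.HodgeArakelov.StableCurveAgreementNonVacuity
import HarnessLib

/-!
# [IUTchII] Def 2.3 (i) / B13: `StableCurveAgreement` non-vacuity with the NATURAL (subspace) topologies

S. Mochizuki, *Inter-universal Teichmüller Theory II*, kurims manuscript (Dec. 2020), §2, Def 2.3 (i)(ii) pp. 67–68;
*Inter-universal Teichmüller Theory I* (May 2020), §2 p. 46 [cite: Mochizuki2012, II Def 2.3 (i)(ii) pp.67–68; I §2 p.46].
abc-iut cell, NV-L6 WAVE row «PlusMinusTower.StableCurveAgreement», seat abc-iut-w5-d132 (gen 2).  PROOF-ONLY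
companion of `StableCurveAgreementNonVacuity.lean`: the same [IUTchI] §2 datum built from a `±`-tower `W`
(`Π̂_{X_v} := Π̂^±_v`, `Π^tp_{X_v} := Π^±_v`, `G_k := G_v`, special fibre := `Δ` with `ℍ := 𝔾`, cusps := the
`Π^±_v`-cuspidal inertia groups of `C`, `eHat := id`), but with the GENUINE subspace topologies on `Π̂^±_v ⊆ Π̂^cor_v`
and `Δ̂^±_v` instead of the indiscrete ones — so that `eHat = id` is tautologically a homeomorphism onto `Π̂_{X_v}`
(what the `Δ`-dictionary consumers of the Cor 2.4 (i) chain additionally ask) — at the price of the two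
topological side conditions the L5 record's `[CompactSpace]` fields need: `Π̂^±_v` compact and `Δ̂^±_v` closed in
it (both hold in print, where `Π̂^cor_v` is profinite and the augmentation continuous).  No `def`, no `instance`;
nothing of the series is asserted; consistency ≠ endorsement; no side taken on [IUTchIII] Cor 3.12.
-/

namespace Literature.IUT.HodgeArakelov

open Literature.IUT.HodgeTheaters
open scoped Pointwise

universe u

variable {S : BadPlaceSetting.{u}} {P : TopGroup.{u}} {T : TemperedCoverings S P}

namespace PlusMinusTower

namespace StableCurveAgreement

/-- **IUTchII:Def2.3(i)** (kurims p.67) **SUFFICIENCY / NON-VACUITY, GENUINE RELATIVE TO `(W, C)`.**  Let `W` be any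
`±`-tower with `Π̂^±_v` compact and `Δ̂^±_v` closed in it, and `C` any cuspidal-inertia datum whose `Π^±_v`-cuspidal
inertia groups lie in `Π^±_v ∩ Δ̂^cor_v` and are stable under `Π^±_v`-conjugation.  Then there is an [IUTchI] §2 datum
`D` (built from `W` itself: `Π̂_{X_v} := Π̂^±_v`, `Π^tp_{X_v} := Π^±_v`, `G_k := G_v`, special fibre := `Δ` with
`ℍ := 𝔾`, `Σ = Σ̂ := {l}`, cusps := the `Π^±_v`-cuspidal inertia groups with `I_x := x`) and an agreement
`StableCurveAgreement W C D` (with `eHat := id`). PROVED — the witness is built inside the term.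
[cite: Mochizuki2012, II Def 2.3 (i)(ii) pp.67–68; I §2 p.46] -/
theorem exists_agreement_of_conj_invariant_subspace (W : PlusMinusTower T) (C : CuspidalInertiaData W)
    (hcpt : CompactSpace W.pmHat)
    (hclosed : IsClosed (((W.aug.comp W.pmHat.subtype).ker : Subgroup W.pmHat) : Set W.pmHat))
    (hgeom : ∀ I : Subgroup W.Corhat, C.IsCuspidalInertia W.piPM I → I ≤ W.aug.ker)
    (hconj : ∀ I : Subgroup W.Corhat, C.IsCuspidalInertia W.piPM I →
      ∀ t ∈ W.piPM, C.IsCuspidalInertia W.piPM (MulAut.conj t • I)) :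
    ∃ D : StableCurveTemperedData.{u}, Nonempty (StableCurveAgreement W C D) := by
  classical
  -- the `Π̂`-side: `H := Π̂^±_v`, `Q := Π^±_v ⊆ H`, `prHat := aug|_H : H → G_v`
  haveI : CompactSpace W.pmHat := hcpt
  let prHat : W.pmHat →* S.Gk := W.aug.comp W.pmHat.subtype
  let Q : Subgroup W.pmHat := W.piPM.subgroupOf W.pmHat
  let prTp : Q →* S.Gk := prHat.comp Q.subtype
  haveI : CompactSpace prHat.ker := isCompact_iff_compactSpace.mp hclosed.isCompact
  -- `Δ^tp ↪ Δ̂` induced by `Q ↪ H`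
  let ιΔ : prTp.ker →* prHat.ker := (Q.subtype.comp prTp.ker.subtype).codRestrict prHat.ker fun d => d.2
  have hιΔ_cont : Continuous ιΔ :=
    (continuous_subtype_val.comp continuous_subtype_val).subtype_mk _
  have hιΔ_inj : Function.Injective ιΔ := fun a b h =>
    Subtype.ext (Subtype.ext (congrArg (fun z : prHat.ker => (z : W.pmHat)) h))
  -- the cusps of the witness: the `Π^±_v`-cuspidal inertia groups of `C`, each its own representative inertia group
  let Cusp : Type u := {I : Subgroup W.Corhat // C.IsCuspidalInertia W.piPM I}
  let toCor : prTp.ker →* W.Corhat := W.pmHat.subtype.comp (Q.subtype.comp prTp.ker.subtype)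
  let inertiaTp : Cusp → Subgroup prTp.ker := fun x => x.1.comap toCor
  -- the [IUTchI] §2 datum built from `W`
  let D : StableCurveTemperedData.{u} :=
    { graph :=
        { Sigma := {S.l}
          SigmaHat := {S.l}
          sigma_subset := subset_rfl
          sigma_nonempty := ⟨S.l, rfl⟩
          sigmaHat_prime := by
            intro q hq
            rw [Set.mem_singleton_iff] at hq
            subst hq
            exact S.l_prime
          Tp := prTp.ker
          Hat := prHat.ker
          ι := ιΔ
          ι_continuous := hιΔ_cont
          ι_injective := hιΔ_inj
          TpH := ⊤
          HatH := ⊤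
          tpH_le := le_top }
      p := S.p
      p_notMem := by
        change S.p ∉ ({S.l} : Set ℕ)
        rw [Set.mem_singleton_iff]
        exact S.p_ne_l
      PiTp := Q
      PiHat := W.pmHat
      Gk := S.Gk
      ιX := Q.subtype
      ιX_continuous := continuous_subtype_val
      ιX_injective := Subtype.val_injective
      prTp := prTp
      prHat := prHat
      prTp_surjective := by
        intro g
        obtain ⟨y, hy, hyg⟩ := aug_surjective_on_piPM W g
        exact ⟨⟨⟨y, W.emb_le_pmHat hy⟩, Subgroup.mem_subgroupOf.mpr hy⟩, hyg⟩
      prHat_comp := rfl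
      ρTp := MonoidHom.id _
      ρHat := MonoidHom.id _
      ρTp_surjective := Function.surjective_id
      ρHat_surjective := Function.surjective_id
      ρ_comp := fun d => rfl
      Cusp := Cusp
      inertiaTp := inertiaTp
      cuspMeetsH := fun _ => True
      Pt := PEmpty.{u + 1}
      decompTp := fun e => nomatch e }
  refine ⟨D, ⟨{ eHat := MulEquiv.refl W.pmHat, map_piPM := ?_, mem_ker_iff := (fun g => Iff.rfl),
                 inertia_iff := ?_ }⟩⟩
  · -- `Π^±_v ∩ Π̂^±_v ↦ ι(Π^tp_{X_v})`: both sides are `Q`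
    change Subgroup.map (MulEquiv.refl W.pmHat).toMonoidHom Q = Q.subtype.range
    rw [Subgroup.range_subtype]
    ext q
    simp
  · exact fun I => isCuspidalInertia_iff_conj_image W C hgeom hconj I


end StableCurveAgreement

end PlusMinusTower

end Literature.IUT.HodgeArakelov
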